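import Summits.BirchSwinnertonDyer.BirchSwinnertonDyer.Theorems.ByReductionTypeAtTwoGoodOrdTowerLayerLutz
import HarnessLib

/-!
# Route `ByReductionTypeAtTwo`, item `OrdKatoHalfAtTwo` (stmt-BirchSwinnertonDyer-19271), TOWER road, the
# GOOD-ORDINARY local tower kernels at `v ∣ 2` at FULL `2`-power depth: BRICK E — Lutz at the layer at depth `p^k`
# from depth `p` by telescoping (pure algebra)

HONEST FRAMING (cell `bsd-2adic`, run/shared/lean/pub/bsd-2adic/, seat `bsd-2adic-tower-1` GEN 20, HUMAN RULINGS
D-0036 / D-0054 / D-0074): TOOL theorem only (pure algebra; no definition, no named fact, no `sorry`); closes nothing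
by itself; nothing booked; BSD is not proved by any of this. Brick E of the programme «UNIFORM layer bound
`∃ C, ∀ n, #𝒦_{v,n}[2^∞] ≤ C` at a good ordinary `2` over `ℚ`» ⇒ `WeierstrassCurve.Greenberg1999_kerG_bounded` at `p = 2`
⇒ Mazur's control theorem `WeierstrassCurve.selmer_control` over `ℚ` at `p = 2` (Greenberg, LNM 1716, Thm. 1.2). GEN 11's
BRICK G6c `natCard_quotient_nsmul_fixedKernel_eq` (`…GoodOrdTowerLayerLutz.lean`) is Lutz at the layer at depth `p`:
`#(E₁(L_n)/p) = #(𝒪_v/p)^{[L_n:K_v]} · #E₁(L_n)[p]`. The depth-`p^k` count needed by the Kummer step at level `p^k` follows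
from it by PURE ALGEBRA, for any additive group `A` with `A/pA` finite and all `A[p^j]` finite:

* `natCard_quotient_nsmul_pow_eq` — if `#(A/pA) = N · #A[p]` then `#(A/p^k A) = N^k · #A[p^k]` for every `k` (with
  finiteness). Proof: `#(A/p^{k+1}A) = #(A/p^kA) · #(p^kA/p^{k+1}A)`, `p^kA/p^{k+1}A ≅ A/(pA + A[p^k])`,
  `#(A/pA) = #(A/(pA + A[p^k])) · #((pA + A[p^k])/pA)`, `(pA + A[p^k])/pA ≅ A[p^k]/(A[p^k] ∩ pA)`, and
  `A[p^k] ∩ pA = p · A[p^{k+1}]` has `#A[p^{k+1}]/#A[p]` elements; the product telescopes.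

References: J. Silverman, *AEC* (2009), Prop. VII.6.3; J. Milne, *ADT* (2006), I Lemma 3.3 (Lutz); scope: this seat's
STATUS line 2026-08-28T08:15:54Z (bricks A′–F).
-/

set_option autoImplicit false
-- the Theorems namespace of this sub repeats the summit name by design (D-0017 nested layout: Summit.<S>.<Sub>)
set_option linter.dupNamespace false

noncomputable section

open scoped Classical

universe u

namespace Summit.BirchSwinnertonDyer.BirchSwinnertonDyer.Theorems.GoodOrdTower

variable {A : Type u} [AddCommGroup A]

/-- `p^{k+1} A ≤ p^k A`. [folklore] -/
private theorem range_nsmul_pow_succ_le (p k : ℕ) :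
    (nsmulAddMonoidHom (p ^ (k + 1)) : A →+ A).range ≤ (nsmulAddMonoidHom (p ^ k) : A →+ A).range := by
  rintro _ ⟨a, rfl⟩
  exact ⟨p • a, by simp only [nsmulAddMonoidHom_apply, pow_succ, mul_smul]⟩

/-- `#G = #(G/H) · #H` transported along an isomorphism `(G/H) ≃+ Q`. [folklore] -/
private theorem natCard_eq_mul_of_equiv {G : Type u} [AddCommGroup G] (H : AddSubgroup G) {Q : Type u}
    [AddCommGroup Q] (e : G ⧸ H ≃+ Q) : Nat.card G = Nat.card Q * Nat.card H := by
  rw [← Nat.card_congr e.toEquiv]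
  exact AddSubgroup.card_eq_card_quotient_mul_card_addSubgroup H

/-- **Step**: `#(A/p^{k+1}A) = #(A/p^kA) · #(A/(pA + A[p^k]))` — the subgroup `p^kA/p^{k+1}A` of `A/p^{k+1}A` is the
image of `a ↦ [p^k a]`, whose kernel is `pA + A[p^k]`. [folklore] -/
private theorem natCard_quotient_succ_eq (p k : ℕ) :
    Nat.card (A ⧸ (nsmulAddMonoidHom (p ^ (k + 1)) : A →+ A).range) =
      Nat.card (A ⧸ (nsmulAddMonoidHom (p ^ k) : A →+ A).range) *
        Nat.card (A ⧸ ((nsmulAddMonoidHom p : A →+ A).range ⊔ (nsmulAddMonoidHom (p ^ k) : A →+ A).ker)) := by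
  let Rk : AddSubgroup A := (nsmulAddMonoidHom (p ^ k) : A →+ A).range
  let Rk1 : AddSubgroup A := (nsmulAddMonoidHom (p ^ (k + 1)) : A →+ A).range
  have hle : Rk1 ≤ Rk := range_nsmul_pow_succ_le p k
  -- `(A/R_{k+1}) / (R_k / R_{k+1}) ≃ A/R_k`
  let e : (A ⧸ Rk1) ⧸ Rk.map (QuotientAddGroup.mk' Rk1) ≃+ A ⧸ Rk :=
    QuotientAddGroup.quotientQuotientEquivQuotient Rk1 Rk hle
  have h1 : Nat.card (A ⧸ Rk1) = Nat.card (A ⧸ Rk) * Nat.card (Rk.map (QuotientAddGroup.mk' Rk1)) :=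
    natCard_eq_mul_of_equiv _ e
  -- `R_k / R_{k+1}` is the image of `ψ : a ↦ [p^k a]`, `ker ψ = pA + A[p^k]`
  let ψ : A →+ A ⧸ Rk1 := (QuotientAddGroup.mk' Rk1).comp (nsmulAddMonoidHom (p ^ k))
  have hψrange : ψ.range = Rk.map (QuotientAddGroup.mk' Rk1) := by
    rw [AddMonoidHom.range_comp]
  have hψker : ψ.ker = (nsmulAddMonoidHom p : A →+ A).range ⊔ (nsmulAddMonoidHom (p ^ k) : A →+ A).ker := by
    ext a
    rw [AddMonoidHom.mem_ker, AddSubgroup.mem_sup]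
    change QuotientAddGroup.mk' Rk1 (p ^ k • a) = 0 ↔ _
    rw [QuotientAddGroup.mk'_apply, QuotientAddGroup.eq_zero_iff]
    constructor
    · rintro ⟨b, hb⟩
      rw [nsmulAddMonoidHom_apply] at hb
      refine ⟨p • b, ⟨b, rfl⟩, a - p • b, ?_, add_sub_cancel (p • b) a⟩
      rw [AddMonoidHom.mem_ker, nsmulAddMonoidHom_apply, smul_sub, ← hb, pow_succ, mul_smul, sub_self]
    · rintro ⟨y, ⟨b, rfl⟩, z, hz, rfl⟩
      rw [AddMonoidHom.mem_ker, nsmulAddMonoidHom_apply] at hz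
      refine ⟨b, ?_⟩
      rw [nsmulAddMonoidHom_apply, nsmulAddMonoidHom_apply, smul_add, hz, add_zero, pow_succ, mul_smul]
  have h2 : Nat.card (Rk.map (QuotientAddGroup.mk' Rk1)) =
      Nat.card (A ⧸ ((nsmulAddMonoidHom p : A →+ A).range ⊔ (nsmulAddMonoidHom (p ^ k) : A →+ A).ker)) := by
    rw [← hψrange, ← hψker]
    exact (Nat.card_congr (QuotientAddGroup.quotientKerEquivRange ψ).toEquiv).symm
  rw [h1, h2]

/-- **Step**: `#(A/pA) · #A[p^{k+1}] = #(A/(pA + A[p^k])) · #A[p^k] · #A[p]` — from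
`#(A/pA) = #(A/(pA + A[p^k])) · #((pA + A[p^k])/pA)`, `(pA + A[p^k])/pA ≅ A[p^k]/(A[p^k] ∩ pA)` and
`A[p^k] ∩ pA = p · A[p^{k+1}] ≅ A[p^{k+1}]/A[p]`. [folklore] -/
private theorem natCard_quotient_mul_ker_succ_eq (p k : ℕ) :
    Nat.card (A ⧸ (nsmulAddMonoidHom p : A →+ A).range) * Nat.card (nsmulAddMonoidHom (p ^ (k + 1)) : A →+ A).ker =
      Nat.card (A ⧸ ((nsmulAddMonoidHom p : A →+ A).range ⊔ (nsmulAddMonoidHom (p ^ k) : A →+ A).ker)) *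
        Nat.card (nsmulAddMonoidHom (p ^ k) : A →+ A).ker * Nat.card (nsmulAddMonoidHom p : A →+ A).ker := by
  let R1 : AddSubgroup A := (nsmulAddMonoidHom p : A →+ A).range
  let Kk : AddSubgroup A := (nsmulAddMonoidHom (p ^ k) : A →+ A).ker
  let Kk1 : AddSubgroup A := (nsmulAddMonoidHom (p ^ (k + 1)) : A →+ A).ker
  let K1 : AddSubgroup A := (nsmulAddMonoidHom p : A →+ A).ker
  let B : AddSubgroup A := R1 ⊔ Kk
  have hle : R1 ≤ B := le_sup_left
  -- `#(A/R1) = #(A/B) · #(B/R1)`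
  let e : (A ⧸ R1) ⧸ B.map (QuotientAddGroup.mk' R1) ≃+ A ⧸ B :=
    QuotientAddGroup.quotientQuotientEquivQuotient R1 B hle
  have h1 : Nat.card (A ⧸ R1) = Nat.card (A ⧸ B) * Nat.card (B.map (QuotientAddGroup.mk' R1)) :=
    natCard_eq_mul_of_equiv _ e
  -- `B/R1` is the image of `Kk → A/R1`, whose kernel is `Kk ∩ R1`
  let θ : Kk →+ A ⧸ R1 := (QuotientAddGroup.mk' R1).comp Kk.subtype
  have hθrange : θ.range = B.map (QuotientAddGroup.mk' R1) := by
    apply le_antisymm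
    · rintro _ ⟨a, rfl⟩
      exact ⟨a, AddSubgroup.mem_sup_right a.2, rfl⟩
    · rintro _ ⟨b, hb, rfl⟩
      obtain ⟨y, hy, z, hz, rfl⟩ := AddSubgroup.mem_sup.mp hb
      refine ⟨⟨z, hz⟩, ?_⟩
      change QuotientAddGroup.mk' R1 z = QuotientAddGroup.mk' R1 (y + z)
      rw [map_add, QuotientAddGroup.mk'_apply R1 y, (QuotientAddGroup.eq_zero_iff y).mpr hy, zero_add]
  have hθker : θ.ker = R1.addSubgroupOf Kk := by
    ext a
    rw [AddMonoidHom.mem_ker, AddSubgroup.mem_addSubgroupOf]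
    change QuotientAddGroup.mk' R1 (a : A) = 0 ↔ _
    rw [QuotientAddGroup.mk'_apply, QuotientAddGroup.eq_zero_iff]
  have h2 : Nat.card Kk = Nat.card (B.map (QuotientAddGroup.mk' R1)) * Nat.card (R1.addSubgroupOf Kk) := by
    rw [← hθrange, ← hθker, ← Nat.card_congr (QuotientAddGroup.quotientKerEquivRange θ).toEquiv]
    exact AddSubgroup.card_eq_card_quotient_mul_card_addSubgroup θ.ker
  -- `Kk ∩ R1` is the image of `·p : K_{k+1} → Kk`, whose kernel is `K1`
  let π : Kk1 →+ Kk :=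
    { toFun := fun a ↦ ⟨p • (a : A), by
        have ha : p ^ (k + 1) • (a : A) = 0 := a.2
        rw [AddMonoidHom.mem_ker, nsmulAddMonoidHom_apply, ← mul_smul, ← pow_succ, ha]⟩
      map_zero' := Subtype.ext (by simp)
      map_add' := fun a b ↦ Subtype.ext (by simp [smul_add]) }
  have hπ : ∀ a : Kk1, ((π a : Kk) : A) = p • (a : A) := fun _ ↦ rfl
  have hπrange : π.range = R1.addSubgroupOf Kk := by
    ext b
    rw [AddSubgroup.mem_addSubgroupOf, AddMonoidHom.mem_range]
    constructor
    · rintro ⟨a, rfl⟩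
      exact ⟨(a : A), by rw [nsmulAddMonoidHom_apply, hπ]⟩
    · rintro ⟨a, ha⟩
      rw [nsmulAddMonoidHom_apply] at ha
      have hak : a ∈ Kk1 := by
        have hb : p ^ k • (b : A) = 0 := b.2
        rw [AddMonoidHom.mem_ker, nsmulAddMonoidHom_apply, pow_succ, mul_smul, ha, hb]
      exact ⟨⟨a, hak⟩, Subtype.ext (by rw [hπ]; exact ha)⟩
  have hπker : Nat.card π.ker = Nat.card K1 := by
    have hK1le : K1 ≤ Kk1 := by
      intro a ha
      rw [AddMonoidHom.mem_ker, nsmulAddMonoidHom_apply] at ha ⊢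
      rw [pow_succ, mul_smul, ha, smul_zero]
    have hk : π.ker = K1.addSubgroupOf Kk1 := by
      ext a
      rw [AddMonoidHom.mem_ker, AddSubgroup.mem_addSubgroupOf, AddMonoidHom.mem_ker, nsmulAddMonoidHom_apply]
      constructor
      · intro h; have h' := congrArg (fun x : Kk ↦ (x : A)) h; rwa [hπ] at h'
      · intro h; exact Subtype.ext (by rw [hπ]; exact h)
    rw [hk]
    exact Nat.card_congr (AddSubgroup.addSubgroupOfEquivOfLe hK1le).toEquiv
  have h3 : Nat.card Kk1 = Nat.card (R1.addSubgroupOf Kk) * Nat.card K1 := by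
    rw [← hπrange, ← hπker, ← Nat.card_congr (QuotientAddGroup.quotientKerEquivRange π).toEquiv]
    exact AddSubgroup.card_eq_card_quotient_mul_card_addSubgroup π.ker
  -- assemble
  calc Nat.card (A ⧸ R1) * Nat.card Kk1
      = Nat.card (A ⧸ B) * Nat.card (B.map (QuotientAddGroup.mk' R1)) * (Nat.card (R1.addSubgroupOf Kk) * Nat.card K1) := by
        rw [h1, h3]
    _ = Nat.card (A ⧸ B) * (Nat.card (B.map (QuotientAddGroup.mk' R1)) * Nat.card (R1.addSubgroupOf Kk)) * Nat.card K1 := by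
        ring
    _ = Nat.card (A ⧸ B) * Nat.card Kk * Nat.card K1 := by rw [← h2]

/-- **Lutz at depth `p^k` from depth `p`, pure algebra.** Let `A` be an additive group with `A/pA` finite of order
`N · #A[p]` and all `A[p^j]` finite. Then for every `k`, `A/p^k A` is finite of order `N^k · #A[p^k]`. (Applied to
`A = E₁(L_n) = Ê(𝔪̄)^{H_n}` with BRICK G6c: `N = #(𝒪_v/p)^{[L_n:K_v]}`, so `#(E₁(L_n)/p^k) = #(𝒪_v/p)^{k[L_n:K_v]} · #E₁(L_n)[p^k]`,
the lower bound on Kummer classes needed at depth `p^k`.) [cite: SilvermanAEC2009, Prop. VII.6.3]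
[cite: MilneADT2006, I Lemma 3.3] -/
theorem natCard_quotient_nsmul_pow_eq (p N : ℕ)
    [Finite (A ⧸ (nsmulAddMonoidHom p : A →+ A).range)]
    (hfin : ∀ j : ℕ, Finite (nsmulAddMonoidHom (p ^ j) : A →+ A).ker)
    (h1 : Nat.card (A ⧸ (nsmulAddMonoidHom p : A →+ A).range) = N * Nat.card (nsmulAddMonoidHom p : A →+ A).ker)
    (k : ℕ) :
    Finite (A ⧸ (nsmulAddMonoidHom (p ^ k) : A →+ A).range) ∧
      Nat.card (A ⧸ (nsmulAddMonoidHom (p ^ k) : A →+ A).range) =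
        N ^ k * Nat.card (nsmulAddMonoidHom (p ^ k) : A →+ A).ker := by
  have hK1 : Finite (nsmulAddMonoidHom p : A →+ A).ker := by
    have h := hfin 1
    rwa [pow_one] at h
  haveI := hK1
  have hK1pos : 0 < Nat.card (nsmulAddMonoidHom p : A →+ A).ker := Nat.card_pos
  induction k with
  | zero =>
    have htop : (nsmulAddMonoidHom (p ^ 0) : A →+ A).range = ⊤ := by
      rw [eq_top_iff]
      intro a _
      exact ⟨a, by rw [nsmulAddMonoidHom_apply, pow_zero, one_smul]⟩
    have hbot : (nsmulAddMonoidHom (p ^ 0) : A →+ A).ker = ⊥ := by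
      rw [eq_bot_iff]
      intro a ha
      rw [AddMonoidHom.mem_ker, nsmulAddMonoidHom_apply, pow_zero, one_smul] at ha
      exact ha
    haveI hsub : Subsingleton (A ⧸ (nsmulAddMonoidHom (p ^ 0) : A →+ A).range) := by
      rw [htop]; exact QuotientAddGroup.subsingleton_quotient_top
    refine ⟨Finite.of_subsingleton, ?_⟩
    have hN0 : N ^ 0 = 1 := pow_zero N
    rw [hN0, one_mul, hbot, AddSubgroup.card_bot]
    exact Nat.card_of_subsingleton (0 : A ⧸ (nsmulAddMonoidHom (p ^ 0) : A →+ A).range)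
  | succ k ih =>
    obtain ⟨hfinQ, hQ⟩ := ih
    haveI := hfinQ
    haveI := hfin k
    haveI := hfin (k + 1)
    have hKkpos : 0 < Nat.card (nsmulAddMonoidHom (p ^ k) : A →+ A).ker := Nat.card_pos
    -- `A/(pA + A[p^k])` is a quotient of the finite `A/pA`
    haveI hfinB : Finite (A ⧸ ((nsmulAddMonoidHom p : A →+ A).range ⊔ (nsmulAddMonoidHom (p ^ k) : A →+ A).ker)) := by
      have e := QuotientAddGroup.quotientQuotientEquivQuotient (nsmulAddMonoidHom p : A →+ A).range
        ((nsmulAddMonoidHom p : A →+ A).range ⊔ (nsmulAddMonoidHom (p ^ k) : A →+ A).ker) le_sup_left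
      haveI : Finite ((A ⧸ (nsmulAddMonoidHom p : A →+ A).range) ⧸
          ((nsmulAddMonoidHom p : A →+ A).range ⊔ (nsmulAddMonoidHom (p ^ k) : A →+ A).ker).map
            (QuotientAddGroup.mk' (nsmulAddMonoidHom p : A →+ A).range)) :=
        Finite.of_surjective _ (QuotientAddGroup.mk'_surjective _)
      exact Finite.of_equiv _ e.toEquiv
    have hstep := natCard_quotient_succ_eq (A := A) p k
    have hcount := natCard_quotient_mul_ker_succ_eq (A := A) p k
    rw [h1] at hcount
    -- `N · #K_{k+1} = #(A/B) · #K_k`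
    have hNB : N * Nat.card (nsmulAddMonoidHom (p ^ (k + 1)) : A →+ A).ker =
        Nat.card (A ⧸ ((nsmulAddMonoidHom p : A →+ A).range ⊔ (nsmulAddMonoidHom (p ^ k) : A →+ A).ker)) *
          Nat.card (nsmulAddMonoidHom (p ^ k) : A →+ A).ker := by
      have h : (N * Nat.card (nsmulAddMonoidHom (p ^ (k + 1)) : A →+ A).ker) * Nat.card (nsmulAddMonoidHom p : A →+ A).ker =
          (Nat.card (A ⧸ ((nsmulAddMonoidHom p : A →+ A).range ⊔ (nsmulAddMonoidHom (p ^ k) : A →+ A).ker)) *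
            Nat.card (nsmulAddMonoidHom (p ^ k) : A →+ A).ker) * Nat.card (nsmulAddMonoidHom p : A →+ A).ker := by
        calc (N * Nat.card (nsmulAddMonoidHom (p ^ (k + 1)) : A →+ A).ker) * Nat.card (nsmulAddMonoidHom p : A →+ A).ker
            = N * Nat.card (nsmulAddMonoidHom p : A →+ A).ker * Nat.card (nsmulAddMonoidHom (p ^ (k + 1)) : A →+ A).ker := by ring
          _ = _ := hcount
      exact Nat.eq_of_mul_eq_mul_right hK1pos h
    -- the count
    have hfinal : Nat.card (A ⧸ (nsmulAddMonoidHom (p ^ (k + 1)) : A →+ A).range) *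
        Nat.card (nsmulAddMonoidHom (p ^ k) : A →+ A).ker =
        (N ^ (k + 1) * Nat.card (nsmulAddMonoidHom (p ^ (k + 1)) : A →+ A).ker) *
          Nat.card (nsmulAddMonoidHom (p ^ k) : A →+ A).ker := by
      calc Nat.card (A ⧸ (nsmulAddMonoidHom (p ^ (k + 1)) : A →+ A).range) * Nat.card (nsmulAddMonoidHom (p ^ k) : A →+ A).ker
          = Nat.card (A ⧸ (nsmulAddMonoidHom (p ^ k) : A →+ A).range) *
              (Nat.card (A ⧸ ((nsmulAddMonoidHom p : A →+ A).range ⊔ (nsmulAddMonoidHom (p ^ k) : A →+ A).ker)) *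
                Nat.card (nsmulAddMonoidHom (p ^ k) : A →+ A).ker) := by rw [hstep]; ring
        _ = N ^ k * Nat.card (nsmulAddMonoidHom (p ^ k) : A →+ A).ker *
              (N * Nat.card (nsmulAddMonoidHom (p ^ (k + 1)) : A →+ A).ker) := by rw [← hNB, hQ]
        _ = _ := by ring
    have hcard := Nat.eq_of_mul_eq_mul_right hKkpos hfinal
    refine ⟨Nat.finite_of_card_ne_zero ?_, hcard⟩
    rw [hcard]
    refine mul_ne_zero (pow_ne_zero _ ?_) (Nat.card_pos (α := (nsmulAddMonoidHom (p ^ (k + 1)) : A →+ A).ker)).ne'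
    -- `N ≠ 0`: `A/pA` is finite and non-empty
    intro hN
    rw [hN, zero_mul] at h1
    exact (Nat.card_pos (α := A ⧸ (nsmulAddMonoidHom p : A →+ A).range)).ne' h1

end Summit.BirchSwinnertonDyer.BirchSwinnertonDyer.Theorems.GoodOrdTower

end
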